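import Summits.Ventures.CertifiedManyBodySolver.Observables.StiffnessApexTransportCurtain
import Summits.Ventures.CertifiedManyBodySolver.Observables.StiffnessApexTransportDoped
import HarnessLib

/-!
# Ventures/CertifiedManyBodySolver — Observables/StiffnessApexTransportCurtainDoped.lean

HONEST FRAMING: one-sided certified CEILINGS on the uniform flux stiffness (`t–t′` f-sum class) at ANY density, transported into a `(t′, U)`
box from a «curtain» of sources and PRICED by certified `K₂` floors on the source classes; a ceiling never speaks to the presence of order; not a
`T_c` estimate, not a superconductivity verdict; every leaf is CONDITIONAL on the row families it names. Zero compute, no definition, no claim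
node, no `sorry`.

Cell `pub/hubbard-downfold` (D-0150 L-DF2 «box ↦ one word»), seat `hubbard-downfold-unc-2` (`prover-hubbard-downfold-unc-2-g15-0`); the doped
edition of `Observables/StiffnessApexTransportCurtain.lean` (half filling) on the engine of `Observables/StiffnessApexTransportDoped.lean` (the
doped apex leaf priced by a source `K₂` floor). Away from `n = 1` the sign `t′K₂ ≤ 0` is gone, so a source row at the slot `σ ≤ t′_P` words the
target only up to the price `(t′_P − σ)·(−B)/2`, `B ≤ K₂` a certified floor on the source class. THE POINT of the curtain at any density: in
the companion's one-station doped box (`…Doped` §2) the lever `t′_P − σ` runs up to `(−p)(1 − U_A/U_max)` (La214-E: `27/148 ≈ 0.182`) because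
the far targets are served from the overhang with their own slots; in the curtain every target is served either from the bottom with
`σ = s ≥ p` or from the left edge / the short overhang with the CORNER slot `σ = p`, so EVERY lever is at most `min(q − p, (−p)(1 − U_A/U_max))`
(La214-E: `1/10`) — and the overhang's a-priori scale is the corner's, as at `n = 1`.

* §1 ENGINE `ObsStiffnessSeqCeilingAt_of_apexSource_orbitLower_slot_of_le_diagHop` (any `0 ≤ n < 2`): source on the apex segment, `U_A ≤ U_P`,
  unconditional orbit-lower statement for `−X₀(σ)` with `σ ≤ t′_P`, floor `B ≤ K₂` on the source class ⇒ leaf at `P` for `c ≥ −v − (t′_P − σ)B/2`;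
* §2 MASTER `ObsStiffnessSeqCeilingAt_on_box_of_curtain_orbitLower_of_le_diagHop`: bottom inner `[p,q] × {U_A}` (own slots, floor `B_B ≤ 0`) + left
  edge `{p} × [U_A, U_L]` (slot `p`, floor `B_L ≤ 0`) + overhang `[p(2 − U_L/U_max), p] × {U_L}` (slot `p`, floor `B_O ≤ 0`), lever `ℓ` with
  `q − p ≤ ℓ ∨ (−p)(1 − U_A/U_max) ≤ ℓ`, prices `−val + ℓ(−B)/2 ≤ c` ⇒ the whole box `[p,q] × [U_A,U_max]`;
* §3 EDITIONS (E1) `U_L = U_A` one station with a corner-slot overhang; (E2) `U_L = U_max` the «L»; §4 the 3-D box (filling interval rides along)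
  for (E1) — the shape `Downfold/StiffnessSeam.holdsOn_stiffnessSeqCeilingAt_of_cell` and the M2(c) closers consume.

NOT said: nothing flows toward smaller `U`; `λ ≠ 0` words are not of this form; no `T > 0`; no number of record.

References: T. Koma, H. Tasaki, J. Stat. Phys. 76 (1994) 745, §1 [KomaTasaki1994]; D. J. Scalapino, S. R. White, S.-C. Zhang, PRB 47 (1993)
7995, §II [ScalapinoWhiteZhang1993]; R. B. Griffiths, Phys. Rev. 152 (1966) 240, §II [Griffiths1966].
-/

noncomputable section

namespace Summit.Ventures.CertifiedManyBodySolver.Observables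

open Literature.MathematicalPhysics.QuantumLattice
open Literature.MathematicalPhysics.QuantumLattice.ThermodynamicLimit
open Literature.MathematicalPhysics.QuantumFieldTheory
open Literature.Probability.LatticeModels
open Matrix Finset Filter Topology HubbardWave0
open scoped Matrix BigOperators ComplexOrder

/-! ## §1 ENGINE (any density): a source row at a slot `σ ≤ t′_P` on the apex segment, priced by a `K₂` floor on the source class -/

section Engine

variable {t'A UA t'P UP n : ℝ}

/-- **Priced slot engine (any density).** Source `A = (t′_A, U_A)` on the apex segment of the target `P = (t′_P, U_P)`:
`U_P·t′_A = (2U_P − U_A)·t′_P`, `0 ≤ U_A ≤ U_P`, `0 < U_P`, density `0 ≤ n < 2`. If every torus limit of unit `(rectN n L, S^z = 0)`-sector ground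
states of `hubbardTorusTT' L 1 t′_A U_A` satisfies the unconditional orbit-lower statement `v ≤ |D₄|⁻¹ Σ_γ Re ω_γ(−X₀(σ, Uo))` at a slot `σ ≤ t′_P` and
carries the floor `B ≤ K₂(ω)`, then `ObsStiffnessSeqCeilingAt t′_P U_P n c` for every `c ≥ −v − (t′_P − σ)·B/2`
(`e_{Φ(1,2σ,0)} + (2t′_P − 2σ)B ≤ e_{Φ(1,2t′_P,0)}` on the source class, then the doubled-hopping apex row). `σ = t′_A` is the companion's
`…_of_apexSource_fsumRow_of_le_diagHop`; at `n = 1`, `B = 0` it is `StiffnessApexTransportCurtain` §1. [cite: KomaTasaki1994, §1] [cite: ScalapinoWhiteZhang1993, §II] -/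
theorem ObsStiffnessSeqCeilingAt_of_apexSource_orbitLower_slot_of_le_diagHop (σ Uo v : ℝ) (hUA : 0 ≤ UA) (hU : UA ≤ UP)
    (hUP : 0 < UP) (hapex : UP * t'A = (2 * UP - UA) * t'P) (hσ : σ ≤ t'P) (hn0 : 0 ≤ n) (hn2 : n < 2)
    (h : ∀ (ω : InfVolFermionState 2) (Ls : ℕ → ℕ) (ψ : ∀ L, Fock (Orb (FermionTorus 2 L))),
      Tendsto Ls atTop atTop →
      (∀ j, IsGroundStateInSector (hubbardTorusTT' (Ls j) 1 t'A UA) (rectN n (Ls j)) 0 (ψ (Ls j))) →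
      (∀ j, star (ψ (Ls j)) ⬝ᵥ ψ (Ls j) = 1) → ω.IsTorusLimitOf ψ Ls →
      v ≤ ((Finset.univ : Finset (DihedralGroup 4)).card : ℝ)⁻¹ * ∑ g ∈ (Finset.univ : Finset (DihedralGroup 4)),
        (ω.expect (d4ShiftSet g 0 (box 2 7)) (fermionEmbed (PolySite.d4Emb g 0 (box 2 7)) (-oddMomentObsTT σ Uo 0))).re)
    {B : ℝ}
    (hB : ∀ (ω : InfVolFermionState 2) (Ls : ℕ → ℕ) (ψ : ∀ L, Fock (Orb (FermionTorus 2 L))),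
      Tendsto Ls atTop atTop →
      (∀ j, IsGroundStateInSector (hubbardTorusTT' (Ls j) 1 t'A UA) (rectN n (Ls j)) 0 (ψ (Ls j))) →
      (∀ j, star (ψ (Ls j)) ⬝ᵥ ψ (Ls j) = 1) → ω.IsTorusLimitOf ψ Ls →
      B ≤ ω.meanEnergy (hubbardTTPrimeFermionInteraction 0 1 0) 1)
    (c : ℚ) (hc : -v - (t'P - σ) * B / 2 ≤ ((c : ℚ) : ℝ)) :
    ObsStiffnessSeqCeilingAt t'P UP n c := by
  intro ρs θ₀ _ hθ₀ Ls hLs hst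
  refine fluxStiffness_le_of_torusLimitTT'_oddMoment_orbit_certificate_seq t'P (U := UP) (δ := 1 - n) (q := ((c : ℚ) : ℝ)) 0
    Finset.univ Finset.univ_nonempty (by linarith) (by linarith) hθ₀ hLs hst ?_
  intro ω Ms ψ hMs hψ h1 hω
  have hψ' : ∀ j, IsGroundStateInSector (hubbardTorusTT' (Ms j) 1 t'P UP) (rectN n (Ms j)) 0 (ψ (Ms j)) := fun j => by
    simpa only [sub_sub_cancel] using hψ j
  rw [orbitMean_rotOddMomentLimitFunctionalTT_lam_zero_eq_meanEnergy_twice_tPrime hω.isTranslationInvariant]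
  have hκ : 2 * σ ≤ 2 * t'P := by linarith
  have e : (2 * t'P - 2 * σ) * B = 2 * ((t'P - σ) * B) := by ring
  rcases hU.eq_or_lt with heq | hlt
  · -- the source class IS the target class (`U_A = U_P` forces `t′_A = t′_P`)
    subst heq
    have htA : t'A = t'P := by
      have h2 : (2 * UA - UA) * t'P = UA * t'P := by ring
      exact mul_left_cancel₀ hUP.ne' (hapex.trans h2)
    subst htA
    have hv := h ω Ms ψ hMs hψ' h1 hω
    rw [orbitMean_re_expect_neg_oddMomentTT_lam_zero hω.isTranslationInvariant] at hv
    have hcmp := InfVolFermionState.meanEnergy_hopping_add_mul_le_of_le_diagHop ω 1 hκ (hB ω Ms ψ hMs hψ' h1 hω)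
    rw [e] at hcmp
    linarith
  · -- genuine transport from an inhabitant of the source class, priced by its `K₂` floor
    obtain ⟨ψA, φ, ωA, hφ, hψA, hψA1, hωA, -, -, -⟩ :=
      exists_isTorusLimitOf_sectorGroundState_TT' 1 t'A UA hn0 hn2.le (Ls := id) tendsto_id
    have hLφ : Tendsto (id ∘ φ : ℕ → ℕ) atTop atTop := tendsto_id.comp hφ.tendsto_atTop
    have hapx := InfVolFermionState.IsTorusLimitOf.meanEnergy_twice_tPrime_le_of_groundStates_apex 1 t'A t'P hUA hlt hapex
      hn0 hn2 hωA hLφ (fun j => hψA _) (fun j => hψA1 _) hω hMs hψ' h1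
    have hcmp := InfVolFermionState.meanEnergy_hopping_add_mul_le_of_le_diagHop ωA 1 hκ
      (hB ωA (id ∘ φ) ψA hLφ (fun j => hψA _) (fun j => hψA1 _) hωA)
    rw [e] at hcmp
    have hv := h ωA (id ∘ φ) ψA hLφ (fun j => hψA _) (fun j => hψA1 _) hωA
    rw [orbitMean_re_expect_neg_oddMomentTT_lam_zero hωA.isTranslationInvariant] at hv
    linarith

end Engine

/-! ## §2 MASTER THEOREM (any density): the curtain, priced by `K₂` floors, every lever at most `min(q − p, (−p)(1 − U_A/U_max))` -/

section Curtain

variable {UA UL Umax p q n : ℝ}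

/-- **THE DOPED CURTAIN THEOREM.** Box `[p, q] × [U_A, U_max]`, `q ≤ 0 < U_A ≤ U_L`, density `0 ≤ n < 2`. Three unconditional
orbit-lower families on torus-limit ground-state classes at density `n`, each with a `K₂` floor on the same classes:
(BOTTOM) `valB s ≤` orbit mean of `−X₀(s)` on the class at `(s, U_A)`, `s ∈ [p, q]`, floor `B_B ≤ K₂`, `B_B ≤ 0`;
(LEFT) `valL U' ≤` orbit mean of `−X₀(p)` on the class at `(p, U')`, `U' ∈ [U_A, U_L]`, floor `B_L ≤ K₂`, `B_L ≤ 0`;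
(OVERHANG at `U_L`) `valO s ≤` orbit mean of the CORNER objective `−X₀(p)` on the class at `(s, U_L)`, `s ∈ [p(2 − U_L/U_max), p]`, floor `B_O ≤ K₂`,
`B_O ≤ 0`. Lever `ℓ` with `q − p ≤ ℓ` OR `(−p)(1 − U_A/U_max) ≤ ℓ`; prices `−valB s + ℓ(−B_B)/2 ≤ c`, `−valL U' + ℓ(−B_L)/2 ≤ c`,
`−valO s + ℓ(−B_O)/2 ≤ c`. Then `ObsStiffnessSeqCeilingAt t′ U n c` at EVERY point of the box. Why every lever is `≤ ℓ`: a bottom source `s ≥ p`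
serves `t′` with `t′ − s = (−t′)(1 − U_A/U) ≤ (−p)(1 − U_A/U_max)` and `t′ − s ≤ t′ − p ≤ q − p`; a left-edge or overhang source (slot `p`) serves a
target whose bottom parameter overhangs, `s_A < p`, so `t′ − p < t′ − s_A ≤ (−p)(1 − U_A/U_max)`, and `t′ − p ≤ q − p`.
[cite: KomaTasaki1994, §1] [cite: ScalapinoWhiteZhang1993, §II] -/
theorem ObsStiffnessSeqCeilingAt_on_box_of_curtain_orbitLower_of_le_diagHop (hUA : 0 < UA) (hAL : UA ≤ UL) (hq : q ≤ 0)
    (hn0 : 0 ≤ n) (hn2 : n < 2) (valB valL valO : ℝ → ℝ) {BB BL BO : ℝ} (hBB0 : BB ≤ 0) (hBL0 : BL ≤ 0)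
    (hBO0 : BO ≤ 0) {ℓ : ℝ} (hℓ : q - p ≤ ℓ ∨ (-p) * (1 - UA / Umax) ≤ ℓ) (c : ℚ)
    (hB : ∀ s ∈ Set.Icc p q,
      ∀ (ω : InfVolFermionState 2) (Ls : ℕ → ℕ) (ψ : ∀ L, Fock (Orb (FermionTorus 2 L))),
      Tendsto Ls atTop atTop →
      (∀ j, IsGroundStateInSector (hubbardTorusTT' (Ls j) 1 s UA) (rectN n (Ls j)) 0 (ψ (Ls j))) →
      (∀ j, star (ψ (Ls j)) ⬝ᵥ ψ (Ls j) = 1) → ω.IsTorusLimitOf ψ Ls →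
      valB s ≤ ((Finset.univ : Finset (DihedralGroup 4)).card : ℝ)⁻¹ * ∑ g ∈ (Finset.univ : Finset (DihedralGroup 4)),
        (ω.expect (d4ShiftSet g 0 (box 2 7)) (fermionEmbed (PolySite.d4Emb g 0 (box 2 7)) (-oddMomentObsTT s UA 0))).re)
    (hKB : ∀ s ∈ Set.Icc p q,
      ∀ (ω : InfVolFermionState 2) (Ls : ℕ → ℕ) (ψ : ∀ L, Fock (Orb (FermionTorus 2 L))),
      Tendsto Ls atTop atTop →
      (∀ j, IsGroundStateInSector (hubbardTorusTT' (Ls j) 1 s UA) (rectN n (Ls j)) 0 (ψ (Ls j))) →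
      (∀ j, star (ψ (Ls j)) ⬝ᵥ ψ (Ls j) = 1) → ω.IsTorusLimitOf ψ Ls →
      BB ≤ ω.meanEnergy (hubbardTTPrimeFermionInteraction 0 1 0) 1)
    (hcB : ∀ s ∈ Set.Icc p q, -valB s + ℓ * (-BB) / 2 ≤ ((c : ℚ) : ℝ))
    (hL : ∀ U' ∈ Set.Icc UA UL,
      ∀ (ω : InfVolFermionState 2) (Ls : ℕ → ℕ) (ψ : ∀ L, Fock (Orb (FermionTorus 2 L))),
      Tendsto Ls atTop atTop →
      (∀ j, IsGroundStateInSector (hubbardTorusTT' (Ls j) 1 p U') (rectN n (Ls j)) 0 (ψ (Ls j))) →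
      (∀ j, star (ψ (Ls j)) ⬝ᵥ ψ (Ls j) = 1) → ω.IsTorusLimitOf ψ Ls →
      valL U' ≤ ((Finset.univ : Finset (DihedralGroup 4)).card : ℝ)⁻¹ * ∑ g ∈ (Finset.univ : Finset (DihedralGroup 4)),
        (ω.expect (d4ShiftSet g 0 (box 2 7)) (fermionEmbed (PolySite.d4Emb g 0 (box 2 7)) (-oddMomentObsTT p U' 0))).re)
    (hKL : ∀ U' ∈ Set.Icc UA UL,
      ∀ (ω : InfVolFermionState 2) (Ls : ℕ → ℕ) (ψ : ∀ L, Fock (Orb (FermionTorus 2 L))),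
      Tendsto Ls atTop atTop →
      (∀ j, IsGroundStateInSector (hubbardTorusTT' (Ls j) 1 p U') (rectN n (Ls j)) 0 (ψ (Ls j))) →
      (∀ j, star (ψ (Ls j)) ⬝ᵥ ψ (Ls j) = 1) → ω.IsTorusLimitOf ψ Ls →
      BL ≤ ω.meanEnergy (hubbardTTPrimeFermionInteraction 0 1 0) 1)
    (hcL : ∀ U' ∈ Set.Icc UA UL, -valL U' + ℓ * (-BL) / 2 ≤ ((c : ℚ) : ℝ))
    (hO : ∀ s ∈ Set.Icc (p * (2 - UL / Umax)) p,
      ∀ (ω : InfVolFermionState 2) (Ls : ℕ → ℕ) (ψ : ∀ L, Fock (Orb (FermionTorus 2 L))),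
      Tendsto Ls atTop atTop →
      (∀ j, IsGroundStateInSector (hubbardTorusTT' (Ls j) 1 s UL) (rectN n (Ls j)) 0 (ψ (Ls j))) →
      (∀ j, star (ψ (Ls j)) ⬝ᵥ ψ (Ls j) = 1) → ω.IsTorusLimitOf ψ Ls →
      valO s ≤ ((Finset.univ : Finset (DihedralGroup 4)).card : ℝ)⁻¹ * ∑ g ∈ (Finset.univ : Finset (DihedralGroup 4)),
        (ω.expect (d4ShiftSet g 0 (box 2 7)) (fermionEmbed (PolySite.d4Emb g 0 (box 2 7)) (-oddMomentObsTT p UL 0))).re)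
    (hKO : ∀ s ∈ Set.Icc (p * (2 - UL / Umax)) p,
      ∀ (ω : InfVolFermionState 2) (Ls : ℕ → ℕ) (ψ : ∀ L, Fock (Orb (FermionTorus 2 L))),
      Tendsto Ls atTop atTop →
      (∀ j, IsGroundStateInSector (hubbardTorusTT' (Ls j) 1 s UL) (rectN n (Ls j)) 0 (ψ (Ls j))) →
      (∀ j, star (ψ (Ls j)) ⬝ᵥ ψ (Ls j) = 1) → ω.IsTorusLimitOf ψ Ls →
      BO ≤ ω.meanEnergy (hubbardTTPrimeFermionInteraction 0 1 0) 1)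
    (hcO : ∀ s ∈ Set.Icc (p * (2 - UL / Umax)) p, -valO s + ℓ * (-BO) / 2 ≤ ((c : ℚ) : ℝ)) :
    ∀ tp ∈ Set.Icc p q, ∀ U ∈ Set.Icc UA Umax, ObsStiffnessSeqCeilingAt tp U n c := by
  intro tp htp U hU
  have hUP : 0 < U := hUA.trans_le hU.1
  have hUne : U ≠ 0 := hUP.ne'
  have htp0 : tp ≤ 0 := htp.2.trans hq
  -- the bottom parameter and its lever `(−t′)(1 − U_A/U) ∈ [0, (−p)(1 − U_A/U_max)]`
  obtain ⟨hlev0, hlev⟩ := apexLever_mem_Icc_of_slab hUA hU.1 hU.2 htp.1 htp0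
  have elev : tp - tp * (2 * U - UA) / U = (-tp) * (1 - UA / U) := by field_simp; ring
  by_cases hsA : p ≤ tp * (2 * U - UA) / U
  · -- (BOTTOM) own slot `σ = s`, lever `t′ − s ≤ ℓ`
    have hmem : tp * (2 * U - UA) / U ∈ Set.Icc p q :=
      ⟨hsA, (apexSource_mem_Icc_of_slab (p := p) hUA hU.1 hU.2 hq htp).2⟩
    have hapexB : U * (tp * (2 * U - UA) / U) = (2 * U - UA) * tp := by
      rw [mul_div_assoc', mul_div_cancel_left₀ _ hUne]; ring
    have hσ : tp * (2 * U - UA) / U ≤ tp := by linarith [elev, hlev0]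
    have hle : tp - tp * (2 * U - UA) / U ≤ ℓ := by
      rcases hℓ with h1 | h2
      · linarith [hsA, htp.2]
      · linarith [elev, hlev]
    refine ObsStiffnessSeqCeilingAt_of_apexSource_orbitLower_slot_of_le_diagHop (tp * (2 * U - UA) / U) UA
      (valB (tp * (2 * U - UA) / U)) hUA.le hU.1 hUP hapexB hσ hn0 hn2 (hB _ hmem) (hKB _ hmem) c ?_
    have hc' := hcB _ hmem
    nlinarith [mul_le_mul_of_nonneg_right hle (neg_nonneg.2 hBB0), sub_nonneg.2 hσ]
  · have hsA : tp * (2 * U - UA) / U < p := not_le.mp hsA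
    have ht0 : tp < 0 := by
      rcases htp0.eq_or_lt with h0 | h0
      · exfalso
        rw [h0, zero_mul, zero_div] at hsA
        exact absurd (htp.1.trans_eq h0) (not_le.2 hsA)
      · exact h0
    have hp0 : p < 0 := lt_of_le_of_lt htp.1 ht0
    obtain ⟨hU'le, hapexL⟩ := leftEdge_apexSource htp.1 ht0 hUP
    have hU'gt : UA < U * (2 - p / tp) := (apexSource_lt_iff_station_lt_leftEdge ht0 hUP).1 hsA
    -- the corner slot's lever `t′ − p < t′ − s_A ≤ (−p)(1 − U_A/U_max)`, and `≤ q − p`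
    have hσ : p ≤ tp := htp.1
    have hle : tp - p ≤ ℓ := by
      rcases hℓ with h1 | h2
      · linarith [htp.2]
      · linarith [elev, hlev, hsA]
    by_cases hUL : U * (2 - p / tp) ≤ UL
    · -- (LEFT EDGE) source `(p, U')`, slot `p`
      have hmem : U * (2 - p / tp) ∈ Set.Icc UA UL := ⟨hU'gt.le, hUL⟩
      refine ObsStiffnessSeqCeilingAt_of_apexSource_orbitLower_slot_of_le_diagHop p (U * (2 - p / tp)) (valL (U * (2 - p / tp)))
        (hUA.le.trans hU'gt.le) hU'le hUP hapexL hσ hn0 hn2 (hL _ hmem) (hKL _ hmem) c ?_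
      have hc' := hcL _ hmem
      nlinarith [mul_le_mul_of_nonneg_right hle (neg_nonneg.2 hBL0), sub_nonneg.2 hσ]
    · -- (OVERHANG at `U_L`) source `(s_L, U_L)`, corner slot `p`
      have hUL : UL < U * (2 - p / tp) := not_le.mp hUL
      have hLU : UL ≤ U := hUL.le.trans hU'le
      have hL0 : 0 < UL := hUA.trans_le hAL
      have hsL : tp * (2 * U - UL) / U < p := (apexSource_lt_iff_station_lt_leftEdge ht0 hUP).2 hUL
      have hmem : tp * (2 * U - UL) / U ∈ Set.Icc (p * (2 - UL / Umax)) p :=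
        ⟨(apexSource_mem_Icc_of_slab (p := p) hL0 hLU hU.2 hq htp).1, hsL.le⟩
      have hapexO : U * (tp * (2 * U - UL) / U) = (2 * U - UL) * tp := by
        rw [mul_div_assoc', mul_div_cancel_left₀ _ hUne]; ring
      refine ObsStiffnessSeqCeilingAt_of_apexSource_orbitLower_slot_of_le_diagHop p UL (valO (tp * (2 * U - UL) / U)) hL0.le hLU hUP
        hapexO hσ hn0 hn2 (hO _ hmem) (hKO _ hmem) c ?_
      have hc' := hcO _ hmem
      nlinarith [mul_le_mul_of_nonneg_right hle (neg_nonneg.2 hBO0), sub_nonneg.2 hσ]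

end Curtain

/-! ## §3 EDITIONS (any density): one station with a corner-slot overhang (E1); the «L» (E2) -/

section Editions

variable {UA Umax p q n : ℝ}

/-- **(E1) ONE STATION, CORNER-SLOT OVERHANG, any density.** Box `[p, q] × [U_A, U_max]` (`p ≤ q ≤ 0 < U_A ≤ U_max`), `0 ≤ n < 2`. INNER own-slot
family `valI` on `[p, q] × {U_A}` with floor `B_I ≤ K₂` (`B_I ≤ 0`); OVERHANG family `valO` for the FIXED corner objective `−X₀(p)` on
`[p(2 − U_A/U_max), p] × {U_A}` with floor `B_O ≤ K₂` (`B_O ≤ 0`); lever `ℓ ≥ q − p` or `ℓ ≥ (−p)(1 − U_A/U_max)`; prices `−valI + ℓ(−B_I)/2 ≤ c`,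
`−valO + ℓ(−B_O)/2 ≤ c`. Then `ObsStiffnessSeqCeilingAt t′ U n c` on the whole box. La214-E M2(c)-type boxes: `ℓ = 1/10` (vs `27/148` in the
companion's `…_on_box_of_forall_apexStation_orbitLower_of_le_diagHop`). [cite: KomaTasaki1994, §1] [cite: ScalapinoWhiteZhang1993, §II] -/
theorem ObsStiffnessSeqCeilingAt_on_box_of_apexStation_inner_and_cornerObjectiveOverhang_of_le_diagHop (hUA : 0 < UA)
    (hUmax : UA ≤ Umax) (hpq : p ≤ q) (hq : q ≤ 0) (hn0 : 0 ≤ n) (hn2 : n < 2) (valI valO : ℝ → ℝ) {BI BO : ℝ} (hBI0 : BI ≤ 0)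
    (hBO0 : BO ≤ 0) {ℓ : ℝ} (hℓ : q - p ≤ ℓ ∨ (-p) * (1 - UA / Umax) ≤ ℓ) (c : ℚ)
    (hI : ∀ s ∈ Set.Icc p q,
      ∀ (ω : InfVolFermionState 2) (Ls : ℕ → ℕ) (ψ : ∀ L, Fock (Orb (FermionTorus 2 L))),
      Tendsto Ls atTop atTop →
      (∀ j, IsGroundStateInSector (hubbardTorusTT' (Ls j) 1 s UA) (rectN n (Ls j)) 0 (ψ (Ls j))) →
      (∀ j, star (ψ (Ls j)) ⬝ᵥ ψ (Ls j) = 1) → ω.IsTorusLimitOf ψ Ls →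
      valI s ≤ ((Finset.univ : Finset (DihedralGroup 4)).card : ℝ)⁻¹ * ∑ g ∈ (Finset.univ : Finset (DihedralGroup 4)),
        (ω.expect (d4ShiftSet g 0 (box 2 7)) (fermionEmbed (PolySite.d4Emb g 0 (box 2 7)) (-oddMomentObsTT s UA 0))).re)
    (hKI : ∀ s ∈ Set.Icc p q,
      ∀ (ω : InfVolFermionState 2) (Ls : ℕ → ℕ) (ψ : ∀ L, Fock (Orb (FermionTorus 2 L))),
      Tendsto Ls atTop atTop →
      (∀ j, IsGroundStateInSector (hubbardTorusTT' (Ls j) 1 s UA) (rectN n (Ls j)) 0 (ψ (Ls j))) →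
      (∀ j, star (ψ (Ls j)) ⬝ᵥ ψ (Ls j) = 1) → ω.IsTorusLimitOf ψ Ls →
      BI ≤ ω.meanEnergy (hubbardTTPrimeFermionInteraction 0 1 0) 1)
    (hcI : ∀ s ∈ Set.Icc p q, -valI s + ℓ * (-BI) / 2 ≤ ((c : ℚ) : ℝ))
    (hO : ∀ s ∈ Set.Icc (p * (2 - UA / Umax)) p,
      ∀ (ω : InfVolFermionState 2) (Ls : ℕ → ℕ) (ψ : ∀ L, Fock (Orb (FermionTorus 2 L))),
      Tendsto Ls atTop atTop →
      (∀ j, IsGroundStateInSector (hubbardTorusTT' (Ls j) 1 s UA) (rectN n (Ls j)) 0 (ψ (Ls j))) →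
      (∀ j, star (ψ (Ls j)) ⬝ᵥ ψ (Ls j) = 1) → ω.IsTorusLimitOf ψ Ls →
      valO s ≤ ((Finset.univ : Finset (DihedralGroup 4)).card : ℝ)⁻¹ * ∑ g ∈ (Finset.univ : Finset (DihedralGroup 4)),
        (ω.expect (d4ShiftSet g 0 (box 2 7)) (fermionEmbed (PolySite.d4Emb g 0 (box 2 7)) (-oddMomentObsTT p UA 0))).re)
    (hKO : ∀ s ∈ Set.Icc (p * (2 - UA / Umax)) p,
      ∀ (ω : InfVolFermionState 2) (Ls : ℕ → ℕ) (ψ : ∀ L, Fock (Orb (FermionTorus 2 L))),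
      Tendsto Ls atTop atTop →
      (∀ j, IsGroundStateInSector (hubbardTorusTT' (Ls j) 1 s UA) (rectN n (Ls j)) 0 (ψ (Ls j))) →
      (∀ j, star (ψ (Ls j)) ⬝ᵥ ψ (Ls j) = 1) → ω.IsTorusLimitOf ψ Ls →
      BO ≤ ω.meanEnergy (hubbardTTPrimeFermionInteraction 0 1 0) 1)
    (hcO : ∀ s ∈ Set.Icc (p * (2 - UA / Umax)) p, -valO s + ℓ * (-BO) / 2 ≤ ((c : ℚ) : ℝ)) :
    ∀ tp ∈ Set.Icc p q, ∀ U ∈ Set.Icc UA Umax, ObsStiffnessSeqCeilingAt tp U n c := by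
  -- the doped curtain with `U_L = U_A`: the left edge degenerates to the corner `(p, U_A)`, an inner source
  refine ObsStiffnessSeqCeilingAt_on_box_of_curtain_orbitLower_of_le_diagHop hUA le_rfl hq hn0 hn2 valI (fun _ => valI p) valO
    hBI0 hBI0 hBO0 hℓ c hI hKI hcI (fun U' hU' => ?_) (fun U' hU' => ?_) (fun U' hU' => ?_) hO hKO hcO
  · have hU'A : U' = UA := le_antisymm hU'.2 hU'.1
    subst hU'A
    exact hI p ⟨le_rfl, hpq⟩
  · have hU'A : U' = UA := le_antisymm hU'.2 hU'.1
    subst hU'A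
    exact hKI p ⟨le_rfl, hpq⟩
  · exact hcI p ⟨le_rfl, hpq⟩

/-- **(E2) THE «L», any density.** Box `[p, q] × [U_A, U_max]` (`q ≤ 0 < U_A ≤ U_max`), `0 ≤ n < 2`. BOTTOM own-slot family `valB` on `[p, q] × {U_A}`
with floor `B_B ≤ K₂` (`≤ 0`); LEFT-EDGE family `valL` (slot `p`, own word) on `{p} × [U_A, U_max]` with floor `B_L ≤ K₂` (`≤ 0`); lever `ℓ ≥ q − p` or
`ℓ ≥ (−p)(1 − U_A/U_max)`; prices `−valB + ℓ(−B_B)/2 ≤ c`, `−valL + ℓ(−B_L)/2 ≤ c`. Then `ObsStiffnessSeqCeilingAt t′ U n c` on the whole box; no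
source outside the box. [cite: KomaTasaki1994, §1] [cite: ScalapinoWhiteZhang1993, §II] -/
theorem ObsStiffnessSeqCeilingAt_on_box_of_bottomEdge_and_leftEdge_of_le_diagHop (hUA : 0 < UA) (hUmax : UA ≤ Umax) (hq : q ≤ 0)
    (hn0 : 0 ≤ n) (hn2 : n < 2) (valB valL : ℝ → ℝ) {BB BL : ℝ} (hBB0 : BB ≤ 0) (hBL0 : BL ≤ 0) {ℓ : ℝ}
    (hℓ : q - p ≤ ℓ ∨ (-p) * (1 - UA / Umax) ≤ ℓ) (c : ℚ)
    (hB : ∀ s ∈ Set.Icc p q,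
      ∀ (ω : InfVolFermionState 2) (Ls : ℕ → ℕ) (ψ : ∀ L, Fock (Orb (FermionTorus 2 L))),
      Tendsto Ls atTop atTop →
      (∀ j, IsGroundStateInSector (hubbardTorusTT' (Ls j) 1 s UA) (rectN n (Ls j)) 0 (ψ (Ls j))) →
      (∀ j, star (ψ (Ls j)) ⬝ᵥ ψ (Ls j) = 1) → ω.IsTorusLimitOf ψ Ls →
      valB s ≤ ((Finset.univ : Finset (DihedralGroup 4)).card : ℝ)⁻¹ * ∑ g ∈ (Finset.univ : Finset (DihedralGroup 4)),
        (ω.expect (d4ShiftSet g 0 (box 2 7)) (fermionEmbed (PolySite.d4Emb g 0 (box 2 7)) (-oddMomentObsTT s UA 0))).re)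
    (hKB : ∀ s ∈ Set.Icc p q,
      ∀ (ω : InfVolFermionState 2) (Ls : ℕ → ℕ) (ψ : ∀ L, Fock (Orb (FermionTorus 2 L))),
      Tendsto Ls atTop atTop →
      (∀ j, IsGroundStateInSector (hubbardTorusTT' (Ls j) 1 s UA) (rectN n (Ls j)) 0 (ψ (Ls j))) →
      (∀ j, star (ψ (Ls j)) ⬝ᵥ ψ (Ls j) = 1) → ω.IsTorusLimitOf ψ Ls →
      BB ≤ ω.meanEnergy (hubbardTTPrimeFermionInteraction 0 1 0) 1)
    (hcB : ∀ s ∈ Set.Icc p q, -valB s + ℓ * (-BB) / 2 ≤ ((c : ℚ) : ℝ))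
    (hL : ∀ U' ∈ Set.Icc UA Umax,
      ∀ (ω : InfVolFermionState 2) (Ls : ℕ → ℕ) (ψ : ∀ L, Fock (Orb (FermionTorus 2 L))),
      Tendsto Ls atTop atTop →
      (∀ j, IsGroundStateInSector (hubbardTorusTT' (Ls j) 1 p U') (rectN n (Ls j)) 0 (ψ (Ls j))) →
      (∀ j, star (ψ (Ls j)) ⬝ᵥ ψ (Ls j) = 1) → ω.IsTorusLimitOf ψ Ls →
      valL U' ≤ ((Finset.univ : Finset (DihedralGroup 4)).card : ℝ)⁻¹ * ∑ g ∈ (Finset.univ : Finset (DihedralGroup 4)),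
        (ω.expect (d4ShiftSet g 0 (box 2 7)) (fermionEmbed (PolySite.d4Emb g 0 (box 2 7)) (-oddMomentObsTT p U' 0))).re)
    (hKL : ∀ U' ∈ Set.Icc UA Umax,
      ∀ (ω : InfVolFermionState 2) (Ls : ℕ → ℕ) (ψ : ∀ L, Fock (Orb (FermionTorus 2 L))),
      Tendsto Ls atTop atTop →
      (∀ j, IsGroundStateInSector (hubbardTorusTT' (Ls j) 1 p U') (rectN n (Ls j)) 0 (ψ (Ls j))) →
      (∀ j, star (ψ (Ls j)) ⬝ᵥ ψ (Ls j) = 1) → ω.IsTorusLimitOf ψ Ls →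
      BL ≤ ω.meanEnergy (hubbardTTPrimeFermionInteraction 0 1 0) 1)
    (hcL : ∀ U' ∈ Set.Icc UA Umax, -valL U' + ℓ * (-BL) / 2 ≤ ((c : ℚ) : ℝ)) :
    ∀ tp ∈ Set.Icc p q, ∀ U ∈ Set.Icc UA Umax, ObsStiffnessSeqCeilingAt tp U n c := by
  -- the doped curtain with `U_L = U_max`: the overhang degenerates to the corner `(p, U_max)`, a left-edge source
  have hmax : 0 < Umax := hUA.trans_le hUmax
  have h2 : p * (2 - Umax / Umax) = p := by rw [div_self hmax.ne']; ring
  refine ObsStiffnessSeqCeilingAt_on_box_of_curtain_orbitLower_of_le_diagHop hUA hUmax hq hn0 hn2 valB valL (fun _ => valL Umax)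
    hBB0 hBL0 hBL0 hℓ c hB hKB hcB hL hKL hcL (fun s hs => ?_) (fun s hs => ?_) (fun s hs => ?_)
  · rw [h2] at hs
    have hsp : s = p := le_antisymm hs.2 hs.1
    subst hsp
    exact hL Umax ⟨hUmax, le_rfl⟩
  · rw [h2] at hs
    have hsp : s = p := le_antisymm hs.2 hs.1
    subst hsp
    exact hKL Umax ⟨hUmax, le_rfl⟩
  · exact hcL Umax ⟨hUmax, le_rfl⟩

end Editions

/-! ## §4 The 3-D box (filling interval rides along) for (E1), any density -/

section Box3

variable {UA Umax p q n₁ n₂ : ℝ}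

/-- **(E1) on the 3-D box `[p,q] × [U_A,U_max] × [n₁,n₂]`.** For every density `x ∈ [n₁, n₂] ⊆ [0, 2)`: an inner own-slot family `valI x` and
an overhang family `valO x` for the FIXED corner objective `−X₀(p)` at the station `U_A`, with `K₂` floors `BI x, BO x ≤ 0` and the prices of §3
at a lever `ℓ ≥ q − p` or `ℓ ≥ (−p)(1 − U_A/U_max)`: then `ObsStiffnessSeqCeilingAt t′ U x c` on the whole 3-D box — the hypothesis shape
`Downfold/StiffnessSeam.holdsOn_stiffnessSeqCeilingAt_of_cell` consumes. [cite: KomaTasaki1994, §1] [cite: ScalapinoWhiteZhang1993, §II] -/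
theorem ObsStiffnessSeqCeilingAt_on_box3_of_apexStation_inner_and_cornerObjectiveOverhang_of_le_diagHop (hUA : 0 < UA)
    (hUmax : UA ≤ Umax) (hpq : p ≤ q) (hq : q ≤ 0) (hn₁ : 0 ≤ n₁) (hn₂ : n₂ < 2) (valI valO : ℝ → ℝ → ℝ) (BI BO : ℝ → ℝ)
    (hBI0 : ∀ x ∈ Set.Icc n₁ n₂, BI x ≤ 0) (hBO0 : ∀ x ∈ Set.Icc n₁ n₂, BO x ≤ 0) {ℓ : ℝ}
    (hℓ : q - p ≤ ℓ ∨ (-p) * (1 - UA / Umax) ≤ ℓ) (c : ℚ)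
    (hI : ∀ x ∈ Set.Icc n₁ n₂, ∀ s ∈ Set.Icc p q,
      ∀ (ω : InfVolFermionState 2) (Ls : ℕ → ℕ) (ψ : ∀ L, Fock (Orb (FermionTorus 2 L))),
      Tendsto Ls atTop atTop →
      (∀ j, IsGroundStateInSector (hubbardTorusTT' (Ls j) 1 s UA) (rectN x (Ls j)) 0 (ψ (Ls j))) →
      (∀ j, star (ψ (Ls j)) ⬝ᵥ ψ (Ls j) = 1) → ω.IsTorusLimitOf ψ Ls →
      valI x s ≤ ((Finset.univ : Finset (DihedralGroup 4)).card : ℝ)⁻¹ * ∑ g ∈ (Finset.univ : Finset (DihedralGroup 4)),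
        (ω.expect (d4ShiftSet g 0 (box 2 7)) (fermionEmbed (PolySite.d4Emb g 0 (box 2 7)) (-oddMomentObsTT s UA 0))).re)
    (hKI : ∀ x ∈ Set.Icc n₁ n₂, ∀ s ∈ Set.Icc p q,
      ∀ (ω : InfVolFermionState 2) (Ls : ℕ → ℕ) (ψ : ∀ L, Fock (Orb (FermionTorus 2 L))),
      Tendsto Ls atTop atTop →
      (∀ j, IsGroundStateInSector (hubbardTorusTT' (Ls j) 1 s UA) (rectN x (Ls j)) 0 (ψ (Ls j))) →
      (∀ j, star (ψ (Ls j)) ⬝ᵥ ψ (Ls j) = 1) → ω.IsTorusLimitOf ψ Ls →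
      BI x ≤ ω.meanEnergy (hubbardTTPrimeFermionInteraction 0 1 0) 1)
    (hcI : ∀ x ∈ Set.Icc n₁ n₂, ∀ s ∈ Set.Icc p q, -valI x s + ℓ * (-BI x) / 2 ≤ ((c : ℚ) : ℝ))
    (hO : ∀ x ∈ Set.Icc n₁ n₂, ∀ s ∈ Set.Icc (p * (2 - UA / Umax)) p,
      ∀ (ω : InfVolFermionState 2) (Ls : ℕ → ℕ) (ψ : ∀ L, Fock (Orb (FermionTorus 2 L))),
      Tendsto Ls atTop atTop →
      (∀ j, IsGroundStateInSector (hubbardTorusTT' (Ls j) 1 s UA) (rectN x (Ls j)) 0 (ψ (Ls j))) →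
      (∀ j, star (ψ (Ls j)) ⬝ᵥ ψ (Ls j) = 1) → ω.IsTorusLimitOf ψ Ls →
      valO x s ≤ ((Finset.univ : Finset (DihedralGroup 4)).card : ℝ)⁻¹ * ∑ g ∈ (Finset.univ : Finset (DihedralGroup 4)),
        (ω.expect (d4ShiftSet g 0 (box 2 7)) (fermionEmbed (PolySite.d4Emb g 0 (box 2 7)) (-oddMomentObsTT p UA 0))).re)
    (hKO : ∀ x ∈ Set.Icc n₁ n₂, ∀ s ∈ Set.Icc (p * (2 - UA / Umax)) p,
      ∀ (ω : InfVolFermionState 2) (Ls : ℕ → ℕ) (ψ : ∀ L, Fock (Orb (FermionTorus 2 L))),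
      Tendsto Ls atTop atTop →
      (∀ j, IsGroundStateInSector (hubbardTorusTT' (Ls j) 1 s UA) (rectN x (Ls j)) 0 (ψ (Ls j))) →
      (∀ j, star (ψ (Ls j)) ⬝ᵥ ψ (Ls j) = 1) → ω.IsTorusLimitOf ψ Ls →
      BO x ≤ ω.meanEnergy (hubbardTTPrimeFermionInteraction 0 1 0) 1)
    (hcO : ∀ x ∈ Set.Icc n₁ n₂, ∀ s ∈ Set.Icc (p * (2 - UA / Umax)) p, -valO x s + ℓ * (-BO x) / 2 ≤ ((c : ℚ) : ℝ)) :
    ∀ tp ∈ Set.Icc p q, ∀ U ∈ Set.Icc UA Umax, ∀ x ∈ Set.Icc n₁ n₂, ObsStiffnessSeqCeilingAt tp U x c := by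
  intro tp htp U hU x hx
  exact ObsStiffnessSeqCeilingAt_on_box_of_apexStation_inner_and_cornerObjectiveOverhang_of_le_diagHop hUA hUmax hpq hq
    (hn₁.trans hx.1) (hx.2.trans_lt hn₂) (valI x) (valO x) (hBI0 x hx) (hBO0 x hx) hℓ c (hI x hx) (hKI x hx) (hcI x hx)
    (hO x hx) (hKO x hx) (hcO x hx) tp htp U hU

end Box3

end Summit.Ventures.CertifiedManyBodySolver.Observables

end
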